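import Summits.AtomisticToContinuum.HydrodynamicLimit.Theses.OneFlightGossipEngine
import Summits.AtomisticToContinuum.HydrodynamicLimit.Theorems.OneFlightGossipEngineKineticCurrentsWindowLDUniformLedgerAssemblyCore
import Summits.AtomisticToContinuum.HydrodynamicLimit.Theorems.OneFlightGossipEngineKineticCurrentsWindowLDUniformAssembly
import Summits.AtomisticToContinuum.HydrodynamicLimit.Theorems.OneFlightGossipEngineKineticCurrentsWindowLDUniformKickFiltration
import Summits.AtomisticToContinuum.HydrodynamicLimit.Theorems.OneFlightGossipEngineKineticCurrentsWindowLDUniformEntropyLedger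
import Literature.MathematicalPhysics.KineticTheory.VelocityBlindPlacement

/-!
# Ledger assembly for the crux `KineticCurrentsWindowLDUniform` (stmt-AtomisticToContinuum-14662),
# line `gossip-forecast-ledger` — registered stub `stub_ledgerAssembly` (S5)

The four other registered stubs of the line skeleton `Cruxes/KineticCurrentsWindowLDUniform/Lines/
gossip_forecast_ledger.lean` — S1 `stub_kickFiltration` (the group kick filtration is Borel and reveals
the group's window functional), S2 `stub_entropyLedger` (the abstract entropy/martingale transportation
inequality `E_Q X − E_Q f₀ ≤ KL(Q‖P)/α + (α/2) E_Q ΣV`), S3 `stub_forecastMoment` (K2: `N`-uniform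
exponential moment of the initial forecast `f₀ = λ[X_S | z_S(0)]`) and S4 `stub_qvMoment` (K3: predictable
quadratic-variation proxy with an `N`-uniform exponential moment) — imply the crux
`OneFlightGossipEngine.KineticCurrentsWindowLDUniform`.  Helper files: A `…LedgerAssemblyDuality`
(tilted-measure duality, entropy inequality, conditional Jensen), B `…LedgerAssemblyStatics` (static
exponential moments of group window functionals), C `…LedgerAssemblyCore` (the ledger at one sign of `β`,
`stub_ledgerAssembly_core`).
The proof here is bookkeeping:

* `η₀ := min (min η₃ η₄) (1/8)`; the activity guard then gives `σ ≤ 1/2` (as in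
  `KineticCurrentsWindowLDUniformSketch.stub_assembly`), so `λ` is a probability measure;
* S3/S4 constants `κ, C₂` and `α, lam, C₃` for `F` and for the sign-flipped `−F` (admissible with
  `(A, b) ↦ (−A, −b)`, same `G`, same growth constant, orthogonality by `integral_neg`), static
  thresholds `c₀(±F)` from file B;
* `β₀ := min over both signs of min (c₀/2) (1/(2(1/κ + 1/α + α/(2 lam))))` — STATIC, as the standing
  disproof record demands (`Cruxes/KineticCurrentsWindowLDUniform/Disproof.lean` §3);
* `β > 0`: file C for `F`; `β < 0`: file C for `−F` at `−β` (`intervalIntegral.integral_neg`);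
  `β = 0`: the integrand is `1`.

`stub_ledgerAssembly_of_moments` is the same implication with S1 and S2 discharged by the landed
`stub_kickFiltration` / `stub_entropyLedger`: the line's transfer `K2 ∧ K3 ⟹ crux`.

References: C. Kipnis, C. Landim, *Scaling Limits of Interacting Particle Systems* (1999), Ch. 6 and
App. 1 §8 (relative entropy method, entropy inequality); H. Spohn, *Large Scale Dynamics of Interacting
Particles* (1991), Part I §2.3 (local Gibbs laws).
-/

noncomputable section

open MeasureTheory Set Filter InformationTheory
open scoped ENNReal Topology Classical ProbabilityTheory

namespace Summit.AtomisticToContinuum.HydrodynamicLimit.Theorems.KineticCurrentsWindowLDUniformGossip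

open Literature.Analysis.FluidPDE (HardSphereFlow Config localMaxwellian collisionTimesOf nthTimeAfter)
open Literature.MathematicalPhysics.KineticTheory (T3 V3 hsDiameter localGibbsLaw isProbabilityMeasure_localGibbsLaw)
open Summit.AtomisticToContinuum.HydrodynamicLimit.Theses.OneFlightGossipEngine (KineticCurrentsWindowLDUniform)
open Summit.AtomisticToContinuum.HydrodynamicLimit.Theorems.KineticCurrentsWindowLDUniformSketch (integral_le_iSup_T3)

/-! ### The registered stub -/

/-- S5 — ASSEMBLY: the kick-filtration measurability (S1), the entropy ledger (S2), the forecast moment K2 (S3) and the QV moment K3 (S4) imply the crux `OneFlightGossipEngine.KineticCurrentsWindowLDUniform` (registered stub `stub_ledgerAssembly` of line `gossip-forecast-ledger`, crux stmt-AtomisticToContinuum-14662). [folklore] -/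
theorem stub_ledgerAssembly :
    (∀ σ : ℝ, 0 < σ → ∀ (a θ₀ : T3 → ℝ) (u₀ : T3 → V3) (N : ℕ)
          (Φ : HardSphereFlow (Literature.Analysis.FluidPDE.Torus.geometry (Fin 3)) (hsDiameter σ N) (N + 1))
          (F : T3 × V3 → ℝ), Continuous F → ∀ τ : ℝ, 0 < τ → ∀ S : Finset (Fin (N + 1)),
          let μ : Measure (Config (N + 1) (Fin 3) T3) := localGibbsLaw σ a u₀ θ₀ N Φ
          let X : Config (N + 1) (Fin 3) T3 → ℝ := fun z => ∑ i ∈ S, (τ * ((N : ℝ) + 1) ^ (-(1 / 3 : ℝ)))⁻¹ * ∫ r in (0 : ℝ)..(τ * ((N : ℝ) + 1) ^ (-(1 / 3 : ℝ))), F ((Φ.flow r z) i)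
          let T : Config (N + 1) (Fin 3) T3 → Set ℝ := fun z =>
            ⋃ i ∈ S, collisionTimesOf (Literature.Analysis.FluidPDE.Torus.geometry (Fin 3)) (hsDiameter σ N) (fun t => Φ.flow t z) i
          let tk : ℕ → Config (N + 1) (Fin 3) T3 → ℝ := fun k z => if z ∈ Φ.good then nthTimeAfter (T z) 0 k else 0
          let ℱ : ℕ → MeasurableSpace (Config (N + 1) (Fin 3) T3) := fun n =>
            MeasurableSpace.comap (fun (z : Config (N + 1) (Fin 3) T3) (i : S) => z i.1) inferInstance ⊔
              ⨆ k < n, MeasurableSpace.comap (fun (z : Config (N + 1) (Fin 3) T3) => (tk k z, fun i : S => Φ.flow (tk k z) z i.1))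
                inferInstance
          (∀ n, ℱ n ≤ (inferInstance : MeasurableSpace (Config (N + 1) (Fin 3) T3))) ∧
            AEStronglyMeasurable[⨆ n, ℱ n] X μ) →
        (∀ (Ω : Type) [mΩ : MeasurableSpace Ω] (P Q : Measure Ω) [IsProbabilityMeasure P] [IsProbabilityMeasure Q],
          Q ≪ P → klDiv Q P ≠ ∞ →
          ∀ (ℱ : ℕ → MeasurableSpace Ω), Monotone ℱ → (∀ n, ℱ n ≤ mΩ) →
          ∀ (X : Ω → ℝ), Integrable X P → Integrable X Q → AEStronglyMeasurable[⨆ n, ℱ n] X P →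
          Integrable (P[X|ℱ 0]) Q →
          ∀ α : ℝ, 0 < α → ∀ (V : ℕ → Ω → ℝ), (∀ k ω, 0 ≤ V k ω) → (∀ k, Measurable[ℱ k] (V k)) →
          (∀ᵐ ω ∂P, Summable (fun k => V k ω)) → Integrable (fun ω => ∑' k, V k ω) Q →
          (∀ (k : ℕ) (s : Set Ω), MeasurableSet[ℱ k] s →
            ∫⁻ ω in s, ENNReal.ofReal (Real.exp (α * ((P[X|ℱ (k + 1)]) ω - (P[X|ℱ k]) ω) - α ^ 2 * V k ω / 2)) ∂P
              ≤ P s) →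
          ∫ ω, X ω ∂Q - ∫ ω, (P[X|ℱ 0]) ω ∂Q ≤ (klDiv Q P).toReal / α + α / 2 * ∫ ω, (∑' k, V k ω) ∂Q) →
        (∃ η₀ : ℝ, 0 < η₀ ∧ ∀ (a θ₀ : T3 → ℝ) (u₀ : T3 → V3), Continuous a → Continuous θ₀ → Continuous u₀ →
          (∀ x, 0 < a x) → (∀ x, 0 < θ₀ x) → ∀ σ : ℝ, 0 < σ → σ ^ 3 * (⨆ x, a x) ≤ η₀ * ∫ x, a x →
          ∀ Φ : (N : ℕ) → HardSphereFlow (Literature.Analysis.FluidPDE.Torus.geometry (Fin 3)) (hsDiameter σ N) (N + 1),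
          ∀ (A : T3 → Fin 3 → Fin 3 → ℝ) (b : T3 → V3) (G : T3 × ℝ → ℝ),
          Continuous A → Continuous b → Continuous G →
          ∀ (F : T3 × V3 → ℝ), (∀ y, F y =
            (∑ j : Fin 3, ∑ k : Fin 3, A y.1 j k * ((y.2 - u₀ y.1) j * (y.2 - u₀ y.1) k)) +
              (∑ j : Fin 3, b y.1 j * (y.2 - u₀ y.1) j) * G (y.1, ‖y.2 - u₀ y.1‖ ^ 2)) →
          ∀ C : ℝ, (∀ y, |F y| ≤ C * (1 + ‖y.2‖ ^ 2)) →
          (∀ x, ∫ v, F (x, v) * localMaxwellian 1 (θ₀ x) (u₀ x) v = 0) →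
          (∀ x (j : Fin 3), ∫ v, F (x, v) * v j * localMaxwellian 1 (θ₀ x) (u₀ x) v = 0) →
          (∀ x, ∫ v, F (x, v) * ‖v‖ ^ 2 * localMaxwellian 1 (θ₀ x) (u₀ x) v = 0) →
          ∃ κ : ℝ, 0 < κ ∧ ∃ C₂ : ℝ, ∀ τ : ℝ, 0 < τ → ∀ δ : ℝ, 0 < δ → ∃ N₀ : ℕ, ∀ N : ℕ, N₀ ≤ N →
          ∀ S : Finset (Fin (N + 1)), 2 * S.card ≤ N + 2 →
          let μ : Measure (Config (N + 1) (Fin 3) T3) := localGibbsLaw σ a u₀ θ₀ N (Φ N)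
          let X : Config (N + 1) (Fin 3) T3 → ℝ := fun z => ∑ i ∈ S, (τ * ((N : ℝ) + 1) ^ (-(1 / 3 : ℝ)))⁻¹ * ∫ r in (0 : ℝ)..(τ * ((N : ℝ) + 1) ^ (-(1 / 3 : ℝ))), F (((Φ N).flow r z) i)
          let T : Config (N + 1) (Fin 3) T3 → Set ℝ := fun z =>
            ⋃ i ∈ S, collisionTimesOf (Literature.Analysis.FluidPDE.Torus.geometry (Fin 3)) (hsDiameter σ N) (fun t => (Φ N).flow t z) i
          let tk : ℕ → Config (N + 1) (Fin 3) T3 → ℝ := fun k z => if z ∈ (Φ N).good then nthTimeAfter (T z) 0 k else 0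
          let ℱ : ℕ → MeasurableSpace (Config (N + 1) (Fin 3) T3) := fun n =>
            MeasurableSpace.comap (fun (z : Config (N + 1) (Fin 3) T3) (i : S) => z i.1) inferInstance ⊔
              ⨆ k < n, MeasurableSpace.comap (fun (z : Config (N + 1) (Fin 3) T3) => (tk k z, fun i : S => (Φ N).flow (tk k z) z i.1))
                inferInstance
          ∫⁻ z, ENNReal.ofReal (Real.exp (κ * (μ[X|ℱ 0]) z)) ∂μ ≤
            ENNReal.ofReal (Real.exp ((C₂ / τ + δ) * ((N : ℝ) + 1)))) →
        (∃ η₀ : ℝ, 0 < η₀ ∧ ∀ (a θ₀ : T3 → ℝ) (u₀ : T3 → V3), Continuous a → Continuous θ₀ → Continuous u₀ →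
          (∀ x, 0 < a x) → (∀ x, 0 < θ₀ x) → ∀ σ : ℝ, 0 < σ → σ ^ 3 * (⨆ x, a x) ≤ η₀ * ∫ x, a x →
          ∀ Φ : (N : ℕ) → HardSphereFlow (Literature.Analysis.FluidPDE.Torus.geometry (Fin 3)) (hsDiameter σ N) (N + 1),
          ∀ (A : T3 → Fin 3 → Fin 3 → ℝ) (b : T3 → V3) (G : T3 × ℝ → ℝ),
          Continuous A → Continuous b → Continuous G →
          ∀ (F : T3 × V3 → ℝ), (∀ y, F y =
            (∑ j : Fin 3, ∑ k : Fin 3, A y.1 j k * ((y.2 - u₀ y.1) j * (y.2 - u₀ y.1) k)) +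
              (∑ j : Fin 3, b y.1 j * (y.2 - u₀ y.1) j) * G (y.1, ‖y.2 - u₀ y.1‖ ^ 2)) →
          ∀ C : ℝ, (∀ y, |F y| ≤ C * (1 + ‖y.2‖ ^ 2)) →
          (∀ x, ∫ v, F (x, v) * localMaxwellian 1 (θ₀ x) (u₀ x) v = 0) →
          (∀ x (j : Fin 3), ∫ v, F (x, v) * v j * localMaxwellian 1 (θ₀ x) (u₀ x) v = 0) →
          (∀ x, ∫ v, F (x, v) * ‖v‖ ^ 2 * localMaxwellian 1 (θ₀ x) (u₀ x) v = 0) →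
          ∃ α : ℝ, 0 < α ∧ ∃ lam : ℝ, 0 < lam ∧ ∃ C₃ : ℝ, ∀ τ : ℝ, 0 < τ → ∀ δ : ℝ, 0 < δ → ∃ N₀ : ℕ, ∀ N : ℕ, N₀ ≤ N →
          ∀ S : Finset (Fin (N + 1)), 2 * S.card ≤ N + 2 →
          let μ : Measure (Config (N + 1) (Fin 3) T3) := localGibbsLaw σ a u₀ θ₀ N (Φ N)
          let X : Config (N + 1) (Fin 3) T3 → ℝ := fun z => ∑ i ∈ S, (τ * ((N : ℝ) + 1) ^ (-(1 / 3 : ℝ)))⁻¹ * ∫ r in (0 : ℝ)..(τ * ((N : ℝ) + 1) ^ (-(1 / 3 : ℝ))), F (((Φ N).flow r z) i)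
          let T : Config (N + 1) (Fin 3) T3 → Set ℝ := fun z =>
            ⋃ i ∈ S, collisionTimesOf (Literature.Analysis.FluidPDE.Torus.geometry (Fin 3)) (hsDiameter σ N) (fun t => (Φ N).flow t z) i
          let tk : ℕ → Config (N + 1) (Fin 3) T3 → ℝ := fun k z => if z ∈ (Φ N).good then nthTimeAfter (T z) 0 k else 0
          let ℱ : ℕ → MeasurableSpace (Config (N + 1) (Fin 3) T3) := fun n =>
            MeasurableSpace.comap (fun (z : Config (N + 1) (Fin 3) T3) (i : S) => z i.1) inferInstance ⊔
              ⨆ k < n, MeasurableSpace.comap (fun (z : Config (N + 1) (Fin 3) T3) => (tk k z, fun i : S => (Φ N).flow (tk k z) z i.1))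
                inferInstance
          ∃ V : ℕ → Config (N + 1) (Fin 3) T3 → ℝ,
            (∀ k z, 0 ≤ V k z) ∧ (∀ k, Measurable[ℱ k] (V k)) ∧ (∀ᵐ z ∂μ, Summable (fun k => V k z)) ∧
            (∀ (k : ℕ) (s : Set (Config (N + 1) (Fin 3) T3)), MeasurableSet[ℱ k] s →
              ∫⁻ z in s, ENNReal.ofReal (Real.exp (α * ((μ[X|ℱ (k + 1)]) z - (μ[X|ℱ k]) z) - α ^ 2 * V k z / 2)) ∂μ
                ≤ μ s) ∧
            ∫⁻ z, ENNReal.ofReal (Real.exp (lam * ∑' k, V k z)) ∂μ ≤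
              ENNReal.ofReal (Real.exp ((C₃ / τ + δ) * ((N : ℝ) + 1)))) →
        KineticCurrentsWindowLDUniform := by
  intro hS1 hS2 hS3 hS4
  obtain ⟨η₃, hη₃, h3⟩ := hS3
  obtain ⟨η₄, hη₄, h4⟩ := hS4
  refine ⟨min (min η₃ η₄) (1 / 8), lt_min (lt_min hη₃ hη₄) (by norm_num), ?_⟩
  intro a θ₀ u₀ ha hθ hu ha0 hθ0 σ hσ hguard Φ A b G hA hb hG hgrowth h1 hv h2
  obtain ⟨C, hC⟩ := hgrowth
  -- the functional of the crux
  set F : T3 × V3 → ℝ := fun y =>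
    (∑ j : Fin 3, ∑ k : Fin 3, A y.1 j k * ((y.2 - u₀ y.1) j * (y.2 - u₀ y.1) k)) +
      (∑ j : Fin 3, b y.1 j * (y.2 - u₀ y.1) j) * G (y.1, ‖y.2 - u₀ y.1‖ ^ 2) with hFdef
  have hFc : Continuous F := by
    rw [hFdef]
    fun_prop
  -- the activity guard: `σ³ sup a ≤ η ∫ a` for `η = η₃, η₄`, and `σ ≤ 1/2`
  -- (adapted from `KineticCurrentsWindowLDUniformSketch.stub_assembly`)
  have hsup_bdd : BddAbove (Set.range a) := (isCompact_range ha).bddAbove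
  have hsup_pos : 0 < ⨆ x, a x := lt_of_lt_of_le (ha0 0) (le_ciSup hsup_bdd 0)
  have hint_le : ∫ x, a x ≤ ⨆ x, a x := integral_le_iSup_T3 ha
  have hint_nn : 0 ≤ ∫ x, a x := integral_nonneg fun x => (ha0 x).le
  have hguard3 : σ ^ 3 * (⨆ x, a x) ≤ η₃ * ∫ x, a x :=
    hguard.trans (mul_le_mul_of_nonneg_right ((min_le_left _ _).trans (min_le_left _ _)) hint_nn)
  have hguard4 : σ ^ 3 * (⨆ x, a x) ≤ η₄ * ∫ x, a x :=
    hguard.trans (mul_le_mul_of_nonneg_right ((min_le_left _ _).trans (min_le_right _ _)) hint_nn)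
  have hσ2 : σ ≤ 1 / 2 := by
    have h8 : σ ^ 3 * (⨆ x, a x) ≤ 1 / 8 * (⨆ x, a x) :=
      hguard.trans ((mul_le_mul_of_nonneg_right (min_le_right _ _) hint_nn).trans
        (mul_le_mul_of_nonneg_left hint_le (by norm_num)))
    have h8' : σ ^ 3 ≤ (1 / 2) ^ 3 := by nlinarith
    exact le_of_pow_le_pow_left₀ (by norm_num) (by norm_num) h8'
  -- the sign-flipped functional `-F`, admissible with `(A, b) ↦ (-A, -b)`
  set Fn : T3 × V3 → ℝ := fun y => -F y with hFndef
  have hFnc : Continuous Fn := by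
    rw [hFndef]
    exact hFc.neg
  have hFn_form : ∀ y, Fn y =
      (∑ j : Fin 3, ∑ k : Fin 3, (fun x j k => -A x j k) y.1 j k * ((y.2 - u₀ y.1) j * (y.2 - u₀ y.1) k)) +
        (∑ j : Fin 3, (fun x => -b x) y.1 j * (y.2 - u₀ y.1) j) * G (y.1, ‖y.2 - u₀ y.1‖ ^ 2) := by
    intro y
    simp only [hFndef, hFdef, neg_mul, Finset.sum_neg_distrib, PiLp.neg_apply, neg_add]
  have hCn : ∀ y, |Fn y| ≤ C * (1 + ‖y.2‖ ^ 2) := fun y => by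
    rw [hFndef]
    simp only [abs_neg]
    exact hC y
  have h1n : ∀ x, ∫ v, Fn (x, v) * localMaxwellian 1 (θ₀ x) (u₀ x) v = 0 := by
    intro x
    simp only [hFndef, neg_mul, integral_neg, h1 x, neg_zero]
  have hvn : ∀ x (j : Fin 3), ∫ v, Fn (x, v) * v j * localMaxwellian 1 (θ₀ x) (u₀ x) v = 0 := by
    intro x j
    simp only [hFndef, neg_mul, integral_neg, hv x j, neg_zero]
  have h2n : ∀ x, ∫ v, Fn (x, v) * ‖v‖ ^ 2 * localMaxwellian 1 (θ₀ x) (u₀ x) v = 0 := by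
    intro x
    simp only [hFndef, neg_mul, integral_neg, h2 x, neg_zero]
  have hAn : Continuous fun (x : T3) (j k : Fin 3) => -A x j k := by fun_prop
  have hbn : Continuous fun x : T3 => -b x := hb.neg
  -- S3 / S4 constants for `F` and for `-F`
  obtain ⟨κ, hκ, C₂, h3F⟩ :=
    h3 a θ₀ u₀ ha hθ hu ha0 hθ0 σ hσ hguard3 Φ A b G hA hb hG F (fun y => rfl) C hC h1 hv h2
  obtain ⟨αp, hαp, lamp, hlamp, C₃, h4F⟩ :=
    h4 a θ₀ u₀ ha hθ hu ha0 hθ0 σ hσ hguard4 Φ A b G hA hb hG F (fun y => rfl) C hC h1 hv h2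
  obtain ⟨κn, hκn, C₂n, h3Fn⟩ :=
    h3 a θ₀ u₀ ha hθ hu ha0 hθ0 σ hσ hguard3 Φ (fun x j k => -A x j k) (fun x => -b x) G hAn hbn hG
      Fn hFn_form C hCn h1n hvn h2n
  obtain ⟨αn, hαn, lamn, hlamn, C₃n, h4Fn⟩ :=
    h4 a θ₀ u₀ ha hθ hu ha0 hθ0 σ hσ hguard4 Φ (fun x j k => -A x j k) (fun x => -b x) G hAn hbn hG
      Fn hFn_form C hCn h1n hvn h2n
  -- static exponential moments for `F` and `-F`
  obtain ⟨c₀, hc₀, hstat⟩ := LedgerAssembly.static_expMoment ha hθ hu ha0 hθ0 hσ hσ2 hFc hC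
  obtain ⟨c₀n, hc₀n, hstatn⟩ := LedgerAssembly.static_expMoment ha hθ hu ha0 hθ0 hσ hσ2 hFnc hCn
  -- `β₀`
  set Kp : ℝ := 1 / κ + 1 / αp + αp / (2 * lamp) with hKpdef
  set Kn : ℝ := 1 / κn + 1 / αn + αn / (2 * lamn) with hKndef
  have hKp0 : 0 < Kp := by positivity
  have hKn0 : 0 < Kn := by positivity
  set βF : ℝ := min (c₀ / 2) (1 / (2 * Kp)) with hβFdef
  set βFn : ℝ := min (c₀n / 2) (1 / (2 * Kn)) with hβFndef
  refine ⟨min βF βFn, lt_min (lt_min (by positivity) (by positivity)) (lt_min (by positivity) (by positivity)), ?_⟩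
  intro β hβ ε hε
  rcases lt_trichotomy β 0 with hβneg | hβ0 | hβpos
  · -- `β < 0`: the ledger for `-F` at `-β`
    have hb0 : -β ≤ βFn := (neg_le_abs β).trans (hβ.trans (min_le_right _ _))
    have hβc : 2 * (-β) ≤ c₀n := by linarith [hb0.trans (min_le_left _ _)]
    have hβ1 : 2 * (-β) * (1 / κn + 1 / αn + αn / (2 * lamn)) ≤ 1 := by
      have h := hb0.trans (min_le_right _ _)
      rw [le_div_iff₀ (by positivity)] at h
      rw [← hKndef]
      linarith
    obtain ⟨τ, hτ, N₀, hN₀⟩ := stub_ledgerAssembly_core hS2 a θ₀ u₀ ha hθ hu ha0 hθ0 σ hσ hσ2 Φ Fn hFnc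
      c₀n hc₀n (fun c hc0 hc1 N T w hw => hstatn c hc0 hc1 N (Φ N) T w hw) κn hκn αn hαn lamn hlamn
      C₂n C₃n
      (by
        intro τ hτ δ hδ
        obtain ⟨N₃, hN₃⟩ := h3Fn τ hτ δ hδ
        obtain ⟨N₄, hN₄⟩ := h4Fn τ hτ δ hδ
        refine ⟨max N₃ N₄, fun N hN S hS => ?_⟩
        obtain ⟨hle, hXae⟩ := hS1 σ hσ a θ₀ u₀ N (Φ N) Fn hFnc τ hτ S
        obtain ⟨V, hV⟩ := hN₄ N (le_of_max_le_right hN) S hS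
        refine ⟨_, ?_, hle, hXae, hN₃ N (le_of_max_le_left hN) S hS, V, hV⟩
        intro m n hmn
        exact sup_le_sup_left (biSup_mono fun k hk => lt_of_lt_of_le hk hmn) _)
      (-β) (neg_pos.2 hβneg) hβc hβ1 ε hε
    refine ⟨τ, hτ, N₀, fun N hN => ?_⟩
    refine le_of_eq_of_le (lintegral_congr fun z => ?_) (hN₀ N hN)
    congr 2
    rw [hFndef]
    simp only [intervalIntegral.integral_neg, mul_neg, Finset.sum_neg_distrib, neg_mul, neg_neg]
  · -- `β = 0`: the integrand is `1`
    subst hβ0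
    refine ⟨1, one_pos, 0, fun N _ => ?_⟩
    haveI := isProbabilityMeasure_localGibbsLaw ha hθ hu ha0 hθ0 hσ2 N (Φ N)
    simp only [zero_mul, Real.exp_zero, ENNReal.ofReal_one, lintegral_const, measure_univ, mul_one]
    exact ENNReal.one_le_ofReal.2 (Real.one_le_exp (by positivity))
  · -- `β > 0`: the ledger for `F` at `β`
    have hb0 : β ≤ βF := (le_abs_self β).trans (hβ.trans (min_le_left _ _))
    have hβc : 2 * β ≤ c₀ := by linarith [hb0.trans (min_le_left _ _)]
    have hβ1 : 2 * β * (1 / κ + 1 / αp + αp / (2 * lamp)) ≤ 1 := by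
      have h := hb0.trans (min_le_right _ _)
      rw [le_div_iff₀ (by positivity)] at h
      rw [← hKpdef]
      linarith
    exact stub_ledgerAssembly_core hS2 a θ₀ u₀ ha hθ hu ha0 hθ0 σ hσ hσ2 Φ F hFc
      c₀ hc₀ (fun c hc0 hc1 N T w hw => hstat c hc0 hc1 N (Φ N) T w hw) κ hκ αp hαp lamp hlamp
      C₂ C₃
      (by
        intro τ hτ δ hδ
        obtain ⟨N₃, hN₃⟩ := h3F τ hτ δ hδ
        obtain ⟨N₄, hN₄⟩ := h4F τ hτ δ hδ
        refine ⟨max N₃ N₄, fun N hN S hS => ?_⟩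
        obtain ⟨hle, hXae⟩ := hS1 σ hσ a θ₀ u₀ N (Φ N) F hFc τ hτ S
        obtain ⟨V, hV⟩ := hN₄ N (le_of_max_le_right hN) S hS
        refine ⟨_, ?_, hle, hXae, hN₃ N (le_of_max_le_left hN) S hS, V, hV⟩
        intro m n hmn
        exact sup_le_sup_left (biSup_mono fun k hk => lt_of_lt_of_le hk hmn) _)
      β hβpos hβc hβ1 ε hε


section Transfer

open Literature.MathematicalPhysics.KineticTheory.VelocityBlindPlacement (Flow Phase)
open Literature.Analysis.FluidPDE.Torus (geometry)
open MeasurableSpace (comap)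

/-- **Registered helper stub `stub_ledgerAssembly_of_moments` — the line's transfer `K2 ∧ K3 ⟹ crux`.**
With S1 (`stub_kickFiltration`, landed in `…KickFiltration.lean`) and S2 (`stub_entropyLedger`, landed in
`…EntropyLedger.lean`) discharged, `stub_ledgerAssembly` reads: the forecast moment K2 (S3
`stub_forecastMoment`) and the QV moment K3 (S4 `stub_qvMoment`) imply the crux
`OneFlightGossipEngine.KineticCurrentsWindowLDUniform`.  (Same two propositions as S3/S4 of the skeleton,
spelled over the tree abbreviations `VelocityBlindPlacement.Flow σ N = HardSphereFlow (Torus.geometry (Fin 3))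
(hsDiameter σ N) (N+1)` and `Phase N = Config (N+1) (Fin 3) 𝕋³` to keep the registered signature one
paragraph.) [folklore] -/
theorem stub_ledgerAssembly_of_moments :
    (∃ η₀ : ℝ, 0 < η₀ ∧ ∀ (a θ₀ : T3 → ℝ) (u₀ : T3 → V3), Continuous a → Continuous θ₀ → Continuous u₀ →
      (∀ x, 0 < a x) → (∀ x, 0 < θ₀ x) → ∀ σ : ℝ, 0 < σ → σ ^ 3 * (⨆ x, a x) ≤ η₀ * ∫ x, a x →
      ∀ Φ : (N : ℕ) → Flow σ N,
      ∀ (A : T3 → Fin 3 → Fin 3 → ℝ) (b : T3 → V3) (G : T3 × ℝ → ℝ),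
      Continuous A → Continuous b → Continuous G →
      ∀ (F : T3 × V3 → ℝ), (∀ y, F y =
        (∑ j : Fin 3, ∑ k : Fin 3, A y.1 j k * ((y.2 - u₀ y.1) j * (y.2 - u₀ y.1) k)) +
          (∑ j : Fin 3, b y.1 j * (y.2 - u₀ y.1) j) * G (y.1, ‖y.2 - u₀ y.1‖ ^ 2)) →
      ∀ C : ℝ, (∀ y, |F y| ≤ C * (1 + ‖y.2‖ ^ 2)) →
      (∀ x, ∫ v, F (x, v) * localMaxwellian 1 (θ₀ x) (u₀ x) v = 0) →
      (∀ x (j : Fin 3), ∫ v, F (x, v) * v j * localMaxwellian 1 (θ₀ x) (u₀ x) v = 0) →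
      (∀ x, ∫ v, F (x, v) * ‖v‖ ^ 2 * localMaxwellian 1 (θ₀ x) (u₀ x) v = 0) →
      ∃ κ : ℝ, 0 < κ ∧ ∃ C₂ : ℝ, ∀ τ : ℝ, 0 < τ → ∀ δ : ℝ, 0 < δ → ∃ N₀ : ℕ, ∀ N : ℕ, N₀ ≤ N →
      ∀ S : Finset (Fin (N + 1)), 2 * S.card ≤ N + 2 →
      let μ : Measure (Phase N) := localGibbsLaw σ a u₀ θ₀ N (Φ N)
      let X : Phase N → ℝ := fun z => ∑ i ∈ S, (τ * ((N : ℝ) + 1) ^ (-(1 / 3 : ℝ)))⁻¹ * ∫ r in (0 : ℝ)..(τ * ((N : ℝ) + 1) ^ (-(1 / 3 : ℝ))), F (((Φ N).flow r z) i)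
      let T : Phase N → Set ℝ := fun z =>
        ⋃ i ∈ S, collisionTimesOf (geometry (Fin 3)) (hsDiameter σ N) (fun t => (Φ N).flow t z) i
      let tk : ℕ → Phase N → ℝ := fun k z => if z ∈ (Φ N).good then nthTimeAfter (T z) 0 k else 0
      let ℱ : ℕ → MeasurableSpace (Phase N) := fun n =>
        comap (fun (z : Phase N) (i : S) => z i.1) inferInstance ⊔
          ⨆ k < n, comap (fun (z : Phase N) => (tk k z, fun i : S => (Φ N).flow (tk k z) z i.1))
            inferInstance
      ∫⁻ z, ENNReal.ofReal (Real.exp (κ * (μ[X|ℱ 0]) z)) ∂μ ≤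
        ENNReal.ofReal (Real.exp ((C₂ / τ + δ) * ((N : ℝ) + 1)))) →
    (∃ η₀ : ℝ, 0 < η₀ ∧ ∀ (a θ₀ : T3 → ℝ) (u₀ : T3 → V3), Continuous a → Continuous θ₀ → Continuous u₀ →
      (∀ x, 0 < a x) → (∀ x, 0 < θ₀ x) → ∀ σ : ℝ, 0 < σ → σ ^ 3 * (⨆ x, a x) ≤ η₀ * ∫ x, a x →
      ∀ Φ : (N : ℕ) → Flow σ N,
      ∀ (A : T3 → Fin 3 → Fin 3 → ℝ) (b : T3 → V3) (G : T3 × ℝ → ℝ),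
      Continuous A → Continuous b → Continuous G →
      ∀ (F : T3 × V3 → ℝ), (∀ y, F y =
        (∑ j : Fin 3, ∑ k : Fin 3, A y.1 j k * ((y.2 - u₀ y.1) j * (y.2 - u₀ y.1) k)) +
          (∑ j : Fin 3, b y.1 j * (y.2 - u₀ y.1) j) * G (y.1, ‖y.2 - u₀ y.1‖ ^ 2)) →
      ∀ C : ℝ, (∀ y, |F y| ≤ C * (1 + ‖y.2‖ ^ 2)) →
      (∀ x, ∫ v, F (x, v) * localMaxwellian 1 (θ₀ x) (u₀ x) v = 0) →
      (∀ x (j : Fin 3), ∫ v, F (x, v) * v j * localMaxwellian 1 (θ₀ x) (u₀ x) v = 0) →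
      (∀ x, ∫ v, F (x, v) * ‖v‖ ^ 2 * localMaxwellian 1 (θ₀ x) (u₀ x) v = 0) →
      ∃ α : ℝ, 0 < α ∧ ∃ lam : ℝ, 0 < lam ∧ ∃ C₃ : ℝ, ∀ τ : ℝ, 0 < τ → ∀ δ : ℝ, 0 < δ → ∃ N₀ : ℕ, ∀ N : ℕ, N₀ ≤ N →
      ∀ S : Finset (Fin (N + 1)), 2 * S.card ≤ N + 2 →
      let μ : Measure (Phase N) := localGibbsLaw σ a u₀ θ₀ N (Φ N)
      let X : Phase N → ℝ := fun z => ∑ i ∈ S, (τ * ((N : ℝ) + 1) ^ (-(1 / 3 : ℝ)))⁻¹ * ∫ r in (0 : ℝ)..(τ * ((N : ℝ) + 1) ^ (-(1 / 3 : ℝ))), F (((Φ N).flow r z) i)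
      let T : Phase N → Set ℝ := fun z =>
        ⋃ i ∈ S, collisionTimesOf (geometry (Fin 3)) (hsDiameter σ N) (fun t => (Φ N).flow t z) i
      let tk : ℕ → Phase N → ℝ := fun k z => if z ∈ (Φ N).good then nthTimeAfter (T z) 0 k else 0
      let ℱ : ℕ → MeasurableSpace (Phase N) := fun n =>
        comap (fun (z : Phase N) (i : S) => z i.1) inferInstance ⊔
          ⨆ k < n, comap (fun (z : Phase N) => (tk k z, fun i : S => (Φ N).flow (tk k z) z i.1))
            inferInstance
      ∃ V : ℕ → Phase N → ℝ,
        (∀ k z, 0 ≤ V k z) ∧ (∀ k, Measurable[ℱ k] (V k)) ∧ (∀ᵐ z ∂μ, Summable (fun k => V k z)) ∧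
        (∀ (k : ℕ) (s : Set (Phase N)), MeasurableSet[ℱ k] s →
          ∫⁻ z in s, ENNReal.ofReal (Real.exp (α * ((μ[X|ℱ (k + 1)]) z - (μ[X|ℱ k]) z) - α ^ 2 * V k z / 2)) ∂μ
            ≤ μ s) ∧
        ∫⁻ z, ENNReal.ofReal (Real.exp (lam * ∑' k, V k z)) ∂μ ≤
          ENNReal.ofReal (Real.exp ((C₃ / τ + δ) * ((N : ℝ) + 1)))) →
        KineticCurrentsWindowLDUniform :=
  fun h3 h4 => stub_ledgerAssembly stub_kickFiltration stub_entropyLedger h3 h4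

end Transfer

end Summit.AtomisticToContinuum.HydrodynamicLimit.Theorems.KineticCurrentsWindowLDUniformGossip

end
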